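import Summits.BirchSwinnertonDyer.BirchSwinnertonDyer.Theorems.Rank2Observatory2DescClKillCurveCertSDefs
import Summits.BirchSwinnertonDyer.BirchSwinnertonDyer.Theorems.Rank2Observatory2DescKillValid
import HarnessLib

/-!
# BirchSwinnertonDyer — rank ≥ 2 observatory: KERNEL-2DESC-CL v3.1, SKV — split-2 certificates with a kill list in VALIDITY form, part 1/3: checkers

HONEST FRAMING: per-curve certified theorems and census instruments; no claim on BSD in rank ≥ 2.

Part 1 of 3.  The v3.0k kill rows (`Rank2Observatory2DescClKillCurveCertS*`, SK) carry each kill as ONE residue-tree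
Boolean `killCheck p … fuel` at a prime `p ∈ killPrimes = [2, …, 23]`.  The K61 census (cert-1 gen 25) finds the
missing kills of the v3.0 'no kill' curves at LARGER bad primes (`29 … 263`), certified by the linear depth-2
certificate `l2Check` (`Rank2Observatory2DescKillLin`) — a different Boolean.  This layer re-types the kill hypothesis
of the SK rows as the shape-independent PROPOSITION `TwoDescKill.KillValidAt` (`Rank2Observatory2DescKillValid`):

* `ClKillS.liteV` — the light clause WITHOUT `p ∈ killPrimes` (`z ≠ 0`, class non-trivial); the kill records, classes,
  representatives, `KillEntry`s and the sieve `admSK` are the SK ones, unchanged;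
* `KillValidS F cc ks : Prop` — every listed kill is at a prime and VALID (`KillValidAt p a b c z t₁ t₂`), supplied per
  kill by `killValidAt_of_killCheck` (tree, any prime), `killValidAt_of_l2Check` (linear depth 2) or any later form;
* `checkSKV F cc r ks` — `checkSK` with `liteV` for `lite`, clause for clause;
* `killListCheckV_of_liteV`, `killValid_entries_of_killValidS`, `noTrivial_of_liteV` — the glue to the validity-form
  list certificate `killListCheckV` / `admKillsV_sound`.

Text = `Rank2Observatory2DescClKillCurveCertSDefs` by the substitution script `generics/v31/tools/mk_skv.py`.
New declarations only; sorry-free. [cite: Cassels1991LecturesEllipticCurves, §15] [cite: CremonaAlgorithms1997, §3.6]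
-/
set_option linter.dupNamespace false

noncomputable section

open scoped Classical NumberField nonZeroDivisors

open Literature.NumberTheory.NumberFields Polynomial Module NumberField IsDedekindDomain Ideal

namespace Summit.BirchSwinnertonDyer.BirchSwinnertonDyer.Rank2Observatory.TwoDescCl

open TwoDescCubic ClFieldCert TwoDescKill

/-! ## Validity-form clauses over the SK kill records -/

section Checkers

variable (F : ClFieldCertS2) (cc : ClCurveCertS)

/-- **Light kill clause, validity form**: `z ≠ 0` and the class is not the trivial class (NO prime list).
Computable. [folklore] -/
def ClKillS.liteV (k : ClKillS) : Bool :=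
  decide (k.z F cc ≠ ((0 : ℤ), (0 : ℤ), (0 : ℤ))) && decide (k.cls cc ≠ ∅)

/-- **The kills of a row, validity form**: every raw kill is at a prime `p` and the quadric pair of its class has no
integer zero primitive at `p` (`TwoDescKill.KillValidAt`, at the `α`-coordinates `(t₁, t₂)` of `X_t = m₁ · e`).  A
hypothesis of the soundness theorem, discharged kill by kill (`killValidS_cons`, part 3) by ANY certificate form.
[cite: CremonaAlgorithms1997, §3.6] -/
def KillValidS (ks : List ClKillS) : Prop :=
  ∀ k ∈ ks, k.p.Prime ∧ KillValidAt k.p F.fs.base.a F.fs.base.b F.fs.base.c (k.z F cc) cc.Xt.2.1 cc.Xt.2.2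

/-- **The split-2 per-curve `r`-checker with a kill list, validity form**: `checkSK F cc r ks` with the light
clause `liteV` (no prime list) in place of `lite`, clause for clause; FEWER THAN `2^(r+1)` classes pass `admSK`.  Computable; run by `decide +kernel`.
[cite: Cassels1991LecturesEllipticCurves, §15] [cite: CremonaAlgorithms1997, §3.6] -/
def checkSKV (r : ℕ) (ks : List ClKillS) : Bool :=
  decide (deltaShort cc.A cc.B cc.C ≠ 0) &&
    noRootMod cc.pF cc.A cc.B cc.C &&
    decide (cubicAtCoords F.fs.base.a F.fs.base.b F.fs.base.c ((F.m₁ : ℤ) * cc.A) ((F.m₁ : ℤ) ^ 2 * cc.B)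
      ((F.m₁ : ℤ) ^ 3 * cc.C) cc.Xt = (0, 0, 0)) &&
    decide (derivAtCoords F.fs.base.a F.fs.base.b F.fs.base.c ((F.m₁ : ℤ) * cc.A) ((F.m₁ : ℤ) ^ 2 * cc.B) cc.Xt =
      MonicCubic.mulCoords F.fs.base.a F.fs.base.b F.fs.base.c (smulCoords (F.m₁ : ℤ) cc.XD)
        (prodPowCoords F.fs.base.a F.fs.base.b F.fs.base.c [])) &&
    (fracOf F cc.Xt cc.tsnT).check F.fs.base.a F.fs.base.b F.fs.base.c &&
    (fracOf F cc.XD cc.tsnD).check F.fs.base.a F.fs.base.b F.fs.base.c &&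
    decide (MonicCubic.disc cc.A cc.B cc.C < 0) &&
    decide (normFormZ F.fs.base.a F.fs.base.b F.fs.base.c cc.XD.1 cc.XD.2.1 cc.XD.2.2 ≠ 0) &&
    decide ((normFormZ F.fs.base.a F.fs.base.b F.fs.base.c cc.XD.1 cc.XD.2.1 cc.XD.2.2).natAbs =
      (cc.dn.map fun pe => pe.1 ^ pe.2).prod) &&
    (cc.dn.all fun pe => primeDispatchS F cc (fracOf F cc.XD cc.tsnD) cc.XD cc.dinvA cc.dmiss2 pe.1) &&
    (cc.codes.all fun bc => codeClauseS F cc bc) &&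
    invCert F.fs.base.a F.fs.base.b F.fs.base.c F.fs.base.w₁ cc.XD cc.dW1 &&
    invCert F.fs.base.a F.fs.base.b F.fs.base.c F.fs.base.w₂ cc.XD cc.dW2 &&
    (cc.Q.all fun q => decide (0 < q)) &&
    decide (cc.head.length = 4) &&
    ((famS cc).all fun f => famCheckS F cc f) &&
    decide (∀ T : Finset (Fin (famS cc).length), T ≠ ∅ →
      ∃ k : Fin (F.fs.base.chars.length + 3), Odd (T.filter fun j => bitS F cc k j = true).card) &&
    (ks.all fun k => k.liteV F cc) &&
    decide (((Finset.univ ×ˢ Finset.univ).filter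
      (fun p : Finset (Fin 0) × Finset (Fin (famS cc).length) => admSK F cc ks p.1 p.2 = true)).card <
        2 ^ (r + 1))

variable {F cc}

/-- The light clauses and the primality of the kill primes give the validity-form list certificate `killListCheckV`
(the product clause holds by `rfl`). [folklore] -/
theorem killListCheckV_of_liteV {ks : List ClKillS} (hl : ∀ k ∈ ks, k.liteV F cc = true) (hk : KillValidS F cc ks) :
    killListCheckV F.fs.base.a F.fs.base.b F.fs.base.c unitCoordsS (famCoordsS cc) (killEntriesS F cc ks) = true := by
  rw [killListCheckV, List.all_eq_true]
  intro e he
  obtain ⟨k, hkm, rfl⟩ := List.mem_map.mp he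
  have h := hl k hkm
  simp only [ClKillS.liteV, Bool.and_eq_true, decide_eq_true_eq] at h
  obtain ⟨hz, -⟩ := h
  simp only [ClKillS.toEntry, Bool.and_eq_true, decide_eq_true_eq]
  exact ⟨⟨(hk k hkm).1, rfl⟩, hz⟩

/-- The validity of every `KillEntry` of the row. [folklore] -/
theorem killValid_entries_of_killValidS {ks : List ClKillS} (hk : KillValidS F cc ks) :
    ∀ e ∈ killEntriesS F cc ks,
      KillValidAt e.p F.fs.base.a F.fs.base.b F.fs.base.c e.z cc.Xt.2.1 cc.Xt.2.2 := by
  intro e he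
  obtain ⟨k, hkm, rfl⟩ := List.mem_map.mp he
  exact (hk k hkm).2

/-- No listed class is the trivial class. [folklore] -/
theorem noTrivial_of_liteV {ks : List ClKillS} (hl : ∀ k ∈ ks, k.liteV F cc = true) :
    ((killEntriesS F cc ks).all fun e => !(decide (e.T = ∅) && decide (e.U = ∅))) = true := by
  rw [List.all_eq_true]
  intro e he
  obtain ⟨k, hkm, rfl⟩ := List.mem_map.mp he
  have h := hl k hkm
  simp only [ClKillS.liteV, Bool.and_eq_true, decide_eq_true_eq] at h
  simp [ClKillS.toEntry, h.2]

end Checkers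

end Summit.BirchSwinnertonDyer.BirchSwinnertonDyer.Rank2Observatory.TwoDescCl

end
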